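import Summits.Ventures.CertifiedManyBodySolver.Rows.HomTorusSpinMagTTPrimeModel
import Summits.Ventures.CertifiedManyBodySolver.Rows.HomTorusTTPrimeEnergyDensity
import Summits.Ventures.CertifiedManyBodySolver.Rows.HomTorusTTPrimeCommutator
import HarnessLib

/-!
# Spin-twisted `t–t'` torus ceiling II — the window gauge for the spin-twisted `t–t'` torus

HONEST FRAMING: first certified bounds; not a superconductivity verdict; every number certified or
labelled float.
`Rows/HomTorusSpinMagWindowGauge.lean` for the `t–t'` model (kernel item K8): for a uniform spin twist
`κ : Fin 2 → Fin 2 → U(1)` of the torus generated by `φ : ℤ² →+ (ℤ/Nℤ)^{d'}`, characters `χ(·, σ)` of `ℤ²`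
with `χ(eᵢ, σ) = κ i σ` — hence `χ(j_s, σ) = diagTwist κ s σ` on the diagonal hops `j₀ = e₀ + e₁`,
`j₁ = e₀ − e₁` (`mulChar_diagVec`) — and a window gauge `ĝ(φ x) = χ(x)` on `Λ'`, the orbital gauge
automorphism `Ad(W_ĝ)` composed with `Γ(ι_{Λ'})` carries a field-free `t–t'` window certificate into the
spin-twisted `t–t'` torus `homHubbardSpinMagTT' φ κ t t' U` (Part I):
(i) the gauged tiling identity for the DIAGONAL energy density
`Σ_v T_v (Ad(W_ĝ) Γ E^{t'}_Φ) T_vᴴ = homHubbardSpinMag (φ ∘ D) (diagTwist κ) t' 0`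
(`sum_fockTranslate_orbGaugeAut_homEmb_diag_meanEnergyObs`) and for the full `t–t'` density
(`sum_fockTranslate_orbGaugeAut_homEmb_TTPrime_meanEnergyObs`); (ii) the diagonal gauge defect
`H^{D}_{ĝ·κ_D} − H^{D}_1` is even and supported off `φ(Λ)` when all eight king-move neighbours of `Λ` lie
in `Λ'` (`homDiagSpinMag_windowGauge_sub_one_mem`); (iii) EOM rows of the `t–t'` window Hamiltonian
transport exactly (`homHubbardSpinMagTT'_commutator_orbGaugeAut_fermionEmbed`, sharp torus hypothesis
`thicken Λ 1 ⊆ Λ'`, `φ` injective on `Λ'`). Translation rows transport by Part III of the nearest-neighbour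
chain verbatim (`orbGaugeAut_homEmb_shift_sub`, Hamiltonian-free).
[cite: ShastrySutherland1990] [cite: Lieb1994, eq. (1)] [cite: XuEtAl2024, eq. (1)]
[cite: Han2020Bootstrap, §3] [cite: BratteliRobinsonII1997, §5.2.2 and §6.2.4]
-/

noncomputable section

open Matrix Finset
open Literature.MathematicalPhysics.QuantumLattice
open Literature.MathematicalPhysics.QuantumFieldTheory hiding Site
open Literature.MathematicalPhysics.QuantumManyBody.StateRelaxation
open Literature.Probability.LatticeModels
open HubbardWave0
open scoped ComplexOrder ComplexConjugate

namespace Summit.Ventures.CertifiedManyBodySolver.Rows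

/-! ### §1. Characters of `ℤ²` on the diagonal hops -/

section DiagChar

/-- `j₀ = e₀ + e₁`. [cite: XuEtAl2024, eq. (1)] -/
theorem diagVec_zero_eq_add : diagVec 0 = unitVec 0 + unitVec 1 := by
  funext i
  fin_cases i <;> simp [diagVec]

/-- `j₁ = e₀ − e₁`. [cite: XuEtAl2024, eq. (1)] -/
theorem diagVec_one_eq_sub : diagVec 1 = unitVec 0 - unitVec 1 := by
  funext i
  fin_cases i <;> simp [diagVec]

/-- **A character with generator values `κ` takes the forced values `diagTwist κ` on the diagonal hops**:
`χ(j_s, σ) = diagTwist κ s σ`. [cite: ShastrySutherland1990] -/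
theorem mulChar_diagVec (κ : Fin 2 → Fin 2 → Circle) (χ : Site 2 → Fin 2 → Circle)
    (hχ : ∀ σ x y, χ (x + y) σ = χ x σ * χ y σ) (hχe : ∀ i σ, χ (unitVec i) σ = κ i σ) (s σ : Fin 2) :
    χ (diagVec s) σ = diagTwist κ s σ := by
  fin_cases s
  · show χ (diagVec 0) σ = diagTwist κ 0 σ
    rw [diagTwist_zero, diagVec_zero_eq_add, hχ, hχe, hχe]
  · show χ (diagVec 1) σ = diagTwist κ 1 σ
    rw [diagTwist_one, diagVec_one_eq_sub, sub_eq_add_neg, hχ, hχe,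
      mulChar_neg (fun x => χ x σ) (hχ σ), hχe]

/-- The character pulled back along `D`: `(χ ∘ D)(·, σ)` is a character of `ℤ²` with generator values
`diagTwist κ`. [folklore] -/
theorem mulChar_comp_diagMap (χ : Site 2 → Fin 2 → Circle) (hχ : ∀ σ x y, χ (x + y) σ = χ x σ * χ y σ)
    (σ : Fin 2) (x y : Site 2) : χ (diagMap (x + y)) σ = χ (diagMap x) σ * χ (diagMap y) σ := by
  rw [map_add, hχ]

/-- `(χ ∘ D)(e_s, σ) = diagTwist κ s σ`. [folklore] -/
theorem mulChar_diagMap_unitVec (κ : Fin 2 → Fin 2 → Circle) (χ : Site 2 → Fin 2 → Circle)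
    (hχ : ∀ σ x y, χ (x + y) σ = χ x σ * χ y σ) (hχe : ∀ i σ, χ (unitVec i) σ = κ i σ) (s σ : Fin 2) :
    χ (diagMap (unitVec s)) σ = diagTwist κ s σ := by
  rw [diagMap_unitVec, mulChar_diagVec κ χ hχ hχe]

end DiagChar

section SpinTTPrimeWindowGauge

variable {d' N : ℕ} [NeZero N] (φ : Site 2 →+ TorusSite d' N)

/-- Elaborate torus identities with the order-derived `DecidableEq` (the convention of the tree's
torus files). -/
local instance (priority := high) instDecidableEqFermionTorusSpinTTPrimeGauge : DecidableEq (FermionTorus d' N) :=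
  LinearOrder.toDecidableEq

/-! ### §2. The gauged tiling identity for the diagonal energy density -/

/-- **Gauged tiling identity (diagonal hops, spin-dependent twist)**: the torus translates of the
ORBITALLY gauged embedded diagonal energy density `Ad(W_ĝ) Γ(ι_{Λ'}) Γ(incl) E^{t'}_Φ` sum to the
diagonal hopping Hamiltonian with the forced phases `diagTwist κ s σ` on every `φ(j_s)`-hop of species
`σ` (no non-degeneracy hypothesis: `homHubbardSpinMag` is a sum over hops, not over graph bonds). [cite: Lieb1994, eq. (1)] [cite: Han2020Bootstrap, §3]
[cite: BratteliRobinsonII1997, §6.2.4] -/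
theorem sum_fockTranslate_orbGaugeAut_homEmb_diag_meanEnergyObs (t' : ℝ) (κ : Fin 2 → Fin 2 → Circle)
    (χ : Site 2 → Fin 2 → Circle) (hχ : ∀ σ x y, χ (x + y) σ = χ x σ * χ y σ)
    (hχe : ∀ i σ, χ (unitVec i) σ = κ i σ) (ĝ : TorusSite d' N → Fin 2 → Circle)
    {Λ' : Finset (Site 2)} (h0 : thicken ({0} : Finset (Site 2)) 1 ⊆ Λ') (hInj' : Set.InjOn φ ↑Λ')
    (hĝ : ∀ x ∈ Λ', ĝ (φ x) = χ x) :
    ∑ v : TorusSite d' N, (fockTranslate v).val *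
        orbGaugeAut (spinSitePhase ĝ)
          (fermionEmbed (homEmb φ hInj')
            (fermionEmbed (PolySite.incl h0) ((diagHoppingFermionInteraction t').meanEnergyObs 1))) *
        (fockTranslate v).valᴴ =
      homHubbardSpinMag (φ.comp diagMap) (fun _ => diagTwist κ) t' 0 := by
  have hInj0 : Set.InjOn φ ↑(thicken ({0} : Finset (Site 2)) 1) := hInj'.mono (by exact_mod_cast h0)
  set o : TorusSite d' N → FermionTorus d' N := FermionTorus.ofTorusSite with ho
  set cd : TorusSite d' N → Fin 2 → Matrix (Finset (Orb (FermionTorus d' N))) (Finset (Orb (FermionTorus d' N))) ℂ :=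
    fun x σ => creation (orb (o x) σ) with hcd
  set c : TorusSite d' N → Fin 2 → Matrix (Finset (Orb (FermionTorus d' N))) (Finset (Orb (FermionTorus d' N))) ℂ :=
    fun x σ => annihilation (orb (o x) σ) with hc
  -- the window gauge at `0` and `±φ(j_s)`, species by species
  have hχ0 : ∀ σ, χ 0 σ = 1 := fun σ => mulChar_zero (fun x => χ x σ) (hχ σ)
  have hχn : ∀ σ x, χ (-x) σ = (χ x σ)⁻¹ := fun σ x => mulChar_neg (fun x => χ x σ) (hχ σ) x
  have hg0 : ∀ σ, (spinSitePhase ĝ (orb (FermionTorus.ofTorusSite (0 : TorusSite d' N)) σ) : ℂ) = 1 := by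
    intro σ
    rw [spinSitePhase_orb, FermionTorus.toTorusSite_ofTorusSite, ← map_zero φ,
      hĝ _ (h0 (zero_mem_thicken_zero 1)), hχ0, Circle.coe_one]
  have hgp : ∀ (s : Fin 2) σ, (spinSitePhase ĝ (orb (FermionTorus.ofTorusSite (φ (diagVec s))) σ) : ℂ) =
      (diagTwist κ s σ : ℂ) := by
    intro s σ
    rw [spinSitePhase_orb, FermionTorus.toTorusSite_ofTorusSite, hĝ _ (h0 (diagVec_mem_thicken_one s)),
      mulChar_diagVec κ χ hχ hχe]
  have hgm : ∀ (s : Fin 2) σ, (spinSitePhase ĝ (orb (FermionTorus.ofTorusSite (-φ (diagVec s))) σ) : ℂ) =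
      conj (diagTwist κ s σ : ℂ) := by
    intro s σ
    rw [spinSitePhase_orb, FermionTorus.toTorusSite_ofTorusSite, ← map_neg,
      hĝ _ (h0 (neg_diagVec_mem_thicken_one s)), hχn, mulChar_diagVec κ χ hχ hχe, Circle.coe_inv_eq_conj]
  have hcomm : ∀ (w : TorusSite d' N) (s : Fin 2), φ (diagVec s) + w = w + φ (diagVec s) :=
    fun w s => add_comm _ _
  -- the translate by `v` of the gauged window diagonal energy density
  have htrans : ∀ v : TorusSite d' N, (fockTranslate v).val *
      orbGaugeAut (spinSitePhase ĝ) (fermionEmbed (homEmb φ hInj')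
        (fermionEmbed (PolySite.incl h0) ((diagHoppingFermionInteraction t').meanEnergyObs 1))) *
      (fockTranslate v).valᴴ =
      ∑ s : Fin 2, ((2 : ℂ)⁻¹ * -(t' : ℂ)) • ∑ σ : Fin 2,
        ((conj (diagTwist κ s σ : ℂ) • (cd v σ * c (v + φ (diagVec s)) σ) +
            (diagTwist κ s σ : ℂ) • (cd (v + φ (diagVec s)) σ * c v σ)) +
          (conj (diagTwist κ s σ : ℂ) • (cd (v - φ (diagVec s)) σ * c v σ) +
            (diagTwist κ s σ : ℂ) • (cd v σ * c (v - φ (diagVec s)) σ))) := by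
    intro v
    rw [← relabel_eq_fockRelabel_conj, fermionEmbed_homEmb_incl φ h0 hInj',
      fermionEmbed_homEmb_diag_meanEnergyObs φ t' hInj0]
    simp only [map_add, map_smul, map_sum, map_mul, orbGaugeAut_creation, orbGaugeAut_annihilation,
      hg0, hgp, hgm, map_one, one_smul, Complex.conj_conj,
      relabel_translate_creation, relabel_translate_annihilation,
      zero_add, neg_add_eq_sub, hcomm, smul_mul_assoc, mul_smul_comm]
    rfl
  simp_rw [htrans]
  rw [Finset.sum_comm]
  have hH : homHubbardSpinMag (φ.comp diagMap) (fun _ => diagTwist κ) t' 0 =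
      -(t' : ℂ) • (∑ x : TorusSite d' N, ∑ s : Fin 2, ∑ σ : Fin 2,
        ((diagTwist κ s σ : ℂ) • (cd (x + φ (diagVec s)) σ * c x σ) +
          conj (diagTwist κ s σ : ℂ) • (cd x σ * c (x + φ (diagVec s)) σ))) := by
    have h := homHubbardSpinMag_eq_sum_torusSite (φ.comp diagMap) (fun _ => diagTwist κ) t' 0
    simp only [comp_diagMap_unitVec, Complex.ofReal_zero, zero_smul, add_zero] at h
    exact h
  rw [hH]
  simp only [Finset.smul_sum]
  conv_rhs => rw [Finset.sum_comm]
  refine Finset.sum_congr rfl fun s _ => ?_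
  have hshift1 : ∑ v : TorusSite d' N, ∑ σ : Fin 2, ((2 : ℂ)⁻¹ * -(t' : ℂ)) •
      (conj (diagTwist κ s σ : ℂ) • (cd (v - φ (diagVec s)) σ * c v σ)) =
      ∑ v : TorusSite d' N, ∑ σ : Fin 2, ((2 : ℂ)⁻¹ * -(t' : ℂ)) •
        (conj (diagTwist κ s σ : ℂ) • (cd v σ * c (v + φ (diagVec s)) σ)) :=
    TorusSite.sum_sub_shift (φ (diagVec s))
      (fun a b => ∑ σ : Fin 2, ((2 : ℂ)⁻¹ * -(t' : ℂ)) • (conj (diagTwist κ s σ : ℂ) • (cd b σ * c a σ)))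
  have hshift2 : ∑ v : TorusSite d' N, ∑ σ : Fin 2, ((2 : ℂ)⁻¹ * -(t' : ℂ)) •
      ((diagTwist κ s σ : ℂ) • (cd v σ * c (v - φ (diagVec s)) σ)) =
      ∑ v : TorusSite d' N, ∑ σ : Fin 2, ((2 : ℂ)⁻¹ * -(t' : ℂ)) •
        ((diagTwist κ s σ : ℂ) • (cd (v + φ (diagVec s)) σ * c v σ)) :=
    TorusSite.sum_sub_shift (φ (diagVec s))
      (fun a b => ∑ σ : Fin 2, ((2 : ℂ)⁻¹ * -(t' : ℂ)) • ((diagTwist κ s σ : ℂ) • (cd a σ * c b σ)))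
  simp only [smul_add, Finset.sum_add_distrib]
  rw [hshift1, hshift2]
  have ha : ∀ z : ℂ, -(t' : ℂ) * z = (2 : ℂ)⁻¹ * -(t' : ℂ) * z + (2 : ℂ)⁻¹ * -(t' : ℂ) * z := fun z => by ring
  rw [← Finset.sum_add_distrib, ← Finset.sum_add_distrib, ← Finset.sum_add_distrib]
  refine Finset.sum_congr rfl fun v _ => ?_
  rw [← Finset.sum_add_distrib, ← Finset.sum_add_distrib, ← Finset.sum_add_distrib]
  refine Finset.sum_congr rfl fun σ _ => ?_
  simp only [smul_smul]
  rw [ha (diagTwist κ s σ : ℂ), ha (conj (diagTwist κ s σ : ℂ)), add_smul, add_smul]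
  abel

/-- **Gauged tiling identity for the `t–t'` energy density**: the torus translates of
`Ad(W_ĝ) Γ(ι_{Λ'}) Γ(incl) E^{tt'}_Φ` sum to the spin-twisted `t–t'` torus Hamiltonian
`homHubbardSpinMagTT' φ κ t t' U`.
[cite: ShastrySutherland1990] [cite: Han2020Bootstrap, §3] [cite: BratteliRobinsonII1997, §6.2.4] -/
theorem sum_fockTranslate_orbGaugeAut_homEmb_TTPrime_meanEnergyObs (t t' U : ℝ) (κ : Fin 2 → Fin 2 → Circle)
    (χ : Site 2 → Fin 2 → Circle) (hχ : ∀ σ x y, χ (x + y) σ = χ x σ * χ y σ)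
    (hχe : ∀ i σ, χ (unitVec i) σ = κ i σ) (ĝ : TorusSite d' N → Fin 2 → Circle)
    {Λ' : Finset (Site 2)} (h0 : thicken ({0} : Finset (Site 2)) 1 ⊆ Λ') (hInj' : Set.InjOn φ ↑Λ')
    (hĝ : ∀ x ∈ Λ', ĝ (φ x) = χ x) :
    ∑ v : TorusSite d' N, (fockTranslate v).val *
        orbGaugeAut (spinSitePhase ĝ)
          (fermionEmbed (homEmb φ hInj')
            (fermionEmbed (PolySite.incl h0) ((hubbardTTPrimeFermionInteraction t t' U).meanEnergyObs 1))) *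
        (fockTranslate v).valᴴ =
      homHubbardSpinMagTT' φ κ t t' U := by
  simp_rw [hubbardTTPrimeFermionInteraction_meanEnergyObs, map_add, Matrix.mul_add, Matrix.add_mul,
    Finset.sum_add_distrib, sum_fockTranslate_orbGaugeAut_homEmb_meanEnergyObs φ t U κ χ hχ hχe ĝ h0 hInj' hĝ,
    sum_fockTranslate_orbGaugeAut_homEmb_diag_meanEnergyObs φ t' κ χ hχ hχe ĝ h0 hInj' hĝ]
  rfl

/-! ### §3. The gauged diagonal field is trivial on every bond the EOM rows see -/

omit [NeZero N] in
/-- **A window gauge removes the forced diagonal phases near `φ(Λ)`.** [cite: Lieb1994, eq. (1)] -/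
theorem homSpinGaugeTransform_diag_windowGauge_eq_one (κ : Fin 2 → Fin 2 → Circle) (χ : Site 2 → Fin 2 → Circle)
    (hχ : ∀ σ x y, χ (x + y) σ = χ x σ * χ y σ) (hχe : ∀ i σ, χ (unitVec i) σ = κ i σ)
    (ĝ : TorusSite d' N → Fin 2 → Circle)
    {Λ Λ' : Finset (Site 2)} (hΛ : Λ ⊆ Λ')
    (hclosedD : ∀ x ∈ Λ, ∀ s : Fin 2, x + diagVec s ∈ Λ' ∧ x - diagVec s ∈ Λ')
    (hĝ : ∀ x ∈ Λ', ĝ (φ x) = χ x) (x : TorusSite d' N) (s : Fin 2)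
    (h : (∃ z ∈ Λ, x = φ z) ∨ (∃ z ∈ Λ, x + φ.comp diagMap (unitVec s) = φ z)) (σ : Fin 2) :
    homSpinGaugeTransform (φ.comp diagMap) ĝ (fun _ => diagTwist κ) x s σ = 1 := by
  obtain ⟨z₀, hz₀, hz₁, hx⟩ : ∃ z₀ : Site 2, z₀ ∈ Λ' ∧ z₀ + diagVec s ∈ Λ' ∧ x = φ z₀ := by
    rcases h with ⟨z, hz, hx'⟩ | ⟨z, hz, hx'⟩
    · exact ⟨z, hΛ hz, (hclosedD z hz s).1, hx'⟩
    · refine ⟨z - diagVec s, (hclosedD z hz s).2, by rw [sub_add_cancel]; exact hΛ hz, ?_⟩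
      rw [map_sub, ← hx', comp_diagMap_unitVec, add_sub_cancel_right]
  have hshift : x + φ.comp diagMap (unitVec s) = φ (z₀ + diagVec s) := by rw [map_add, hx, comp_diagMap_unitVec]
  simp only [homSpinGaugeTransform]
  rw [hshift, hx, hĝ _ hz₀, hĝ _ hz₁, hχ, mulChar_diagVec κ χ hχ hχe]
  exact mul_inv_cancel _

/-- **The diagonal gauge defect is localised away from `φ(Λ)`**: `H^D_{ĝ·κ_D} − H^D_1` lies in the even
CAR algebra of the orbitals off `φ(Λ)`. [cite: BratteliRobinsonII1997, §5.2.2] -/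
theorem homDiagSpinMag_windowGauge_sub_one_mem (t' : ℝ)
    (κ : Fin 2 → Fin 2 → Circle) (χ : Site 2 → Fin 2 → Circle)
    (hχ : ∀ σ x y, χ (x + y) σ = χ x σ * χ y σ) (hχe : ∀ i σ, χ (unitVec i) σ = κ i σ)
    (ĝ : TorusSite d' N → Fin 2 → Circle) {Λ Λ' : Finset (Site 2)}
    (hΛ : Λ ⊆ Λ') (hclosedD : ∀ x ∈ Λ, ∀ s : Fin 2, x + diagVec s ∈ Λ' ∧ x - diagVec s ∈ Λ')
    (hInj' : Set.InjOn φ ↑Λ') (hĝ : ∀ x ∈ Λ', ĝ (φ x) = χ x) :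
    homHubbardSpinMag (φ.comp diagMap) (homSpinGaugeTransform (φ.comp diagMap) ĝ (fun _ => diagTwist κ)) t' 0 -
        homHubbardSpinMag (φ.comp diagMap) 1 t' 0 ∈
      carEvenSubalgebra (orbs ((Finset.univ : Finset (PolySite Λ)).map
        ((PolySite.incl hΛ).trans (homEmb φ hInj'))))ᶜ := by
  have hmem : ∀ y : TorusSite d' N, (∀ z ∈ Λ, y ≠ φ z) → ∀ τ : Fin 2,
      orb (FermionTorus.ofTorusSite y) τ ∈ (orbs ((Finset.univ : Finset (PolySite Λ)).map
        ((PolySite.incl hΛ).trans (homEmb φ hInj'))))ᶜ := by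
    intro y hy τ
    refine Finset.mem_compl.2 fun h' => ?_
    obtain ⟨p, -, hp⟩ := Finset.mem_map.1 (orb_mem_orbs.1 h')
    have h2 : FermionTorus.ofTorusSite (φ (ofLex p.1)) = FermionTorus.ofTorusSite y := by
      rw [← hp, Function.Embedding.trans_apply, homEmb_apply, PolySite.coe_incl]
    have h3 := congrArg FermionTorus.toTorusSite h2
    rw [FermionTorus.toTorusSite_ofTorusSite, FermionTorus.toTorusSite_ofTorusSite] at h3
    exact hy (ofLex p.1) (PolySite.ofLex_mem p) h3.symm
  set A' := homSpinGaugeTransform (φ.comp diagMap) ĝ (fun _ => diagTwist κ) with hA'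
  unfold homHubbardSpinMag
  rw [add_sub_add_right_eq_sub, ← smul_sub]
  refine SMulMemClass.smul_mem _ ?_
  rw [← Finset.sum_sub_distrib]
  refine sum_mem fun x _ => ?_
  rw [← Finset.sum_sub_distrib]
  refine sum_mem fun s _ => ?_
  rw [← Finset.sum_sub_distrib]
  refine sum_mem fun σ _ => ?_
  by_cases h : (∃ z ∈ Λ, x = φ z) ∨ (∃ z ∈ Λ, x + φ.comp diagMap (unitVec s) = φ z)
  · have h1 : A' x s σ = 1 :=
      homSpinGaugeTransform_diag_windowGauge_eq_one φ κ χ hχ hχe ĝ hΛ hclosedD hĝ x s h σ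
    rw [h1, Pi.one_apply, Pi.one_apply, Pi.one_apply, sub_self]
    exact zero_mem _
  · push Not at h
    have hxS : ∀ τ, orb (FermionTorus.ofTorusSite x) τ ∈ (orbs ((Finset.univ : Finset (PolySite Λ)).map
        ((PolySite.incl hΛ).trans (homEmb φ hInj'))))ᶜ := hmem x h.1
    have hyS : ∀ τ, orb (FermionTorus.ofTorusSite (x + φ.comp diagMap (unitVec s))) τ ∈
        (orbs ((Finset.univ : Finset (PolySite Λ)).map ((PolySite.incl hΛ).trans (homEmb φ hInj'))))ᶜ :=
      hmem _ h.2
    refine sub_mem (add_mem (SMulMemClass.smul_mem _ ?_) (SMulMemClass.smul_mem _ ?_))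
      (add_mem (SMulMemClass.smul_mem _ ?_) (SMulMemClass.smul_mem _ ?_))
    · exact creation_mul_annihilation_mem_carEvenSubalgebra (hyS σ) (hxS σ)
    · exact creation_mul_annihilation_mem_carEvenSubalgebra (hxS σ) (hyS σ)
    · exact creation_mul_annihilation_mem_carEvenSubalgebra (hyS σ) (hxS σ)
    · exact creation_mul_annihilation_mem_carEvenSubalgebra (hxS σ) (hyS σ)

/-- **The full `t–t'` gauge defect is localised away from `φ(Λ)`**: `H_{ĝ·κ, ĝ·κ_D} − homHubbardTT' φ`
lies in the even CAR algebra of the orbitals off `φ(Λ)` (sharp hypothesis `thicken Λ 1 ⊆ Λ'`,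
non-degenerate hops of both graphs). [cite: BratteliRobinsonII1997, §5.2.2] -/
theorem homHubbardSpinMagTT'Gen_windowGauge_sub_mem (t t' U : ℝ)
    (κ : Fin 2 → Fin 2 → Circle) (χ : Site 2 → Fin 2 → Circle)
    (hχ : ∀ σ x y, χ (x + y) σ = χ x σ * χ y σ) (hχe : ∀ i σ, χ (unitVec i) σ = κ i σ)
    (ĝ : TorusSite d' N → Fin 2 → Circle) (hd : Function.Injective (signedHop φ))
    (hd' : Function.Injective (signedHop (φ.comp diagMap))) {Λ Λ' : Finset (Site 2)}
    (hΛ : Λ ⊆ Λ') (h8 : thicken Λ 1 ⊆ Λ') (hInj' : Set.InjOn φ ↑Λ') (hĝ : ∀ x ∈ Λ', ĝ (φ x) = χ x) :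
    homHubbardSpinMagTT'Gen φ (homSpinGaugeTransform φ ĝ (fun _ => κ))
          (homSpinGaugeTransform (φ.comp diagMap) ĝ (fun _ => diagTwist κ)) t t' U -
        homHubbardTT' φ t t' U ∈
      carEvenSubalgebra (orbs ((Finset.univ : Finset (PolySite Λ)).map
        ((PolySite.incl hΛ).trans (homEmb φ hInj'))))ᶜ := by
  obtain ⟨hclosed, hclosedD⟩ := neighbours_mem_of_thicken_subset h8
  have h1 := homHubbardSpinMag_windowGauge_sub_one_mem φ t U κ χ hχ hχe ĝ hΛ hclosed hInj' hĝ
  have h2 := homDiagSpinMag_windowGauge_sub_one_mem φ t' κ χ hχ hχe ĝ hΛ hclosedD hInj' hĝ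
  rw [homHubbardSpinMag_one_eq_homHubbard φ hd t U] at h1
  rw [homHubbardSpinMag_one_eq_homHubbard (φ.comp diagMap) hd' t' 0] at h2
  have e : homHubbardSpinMagTT'Gen φ (homSpinGaugeTransform φ ĝ (fun _ => κ))
        (homSpinGaugeTransform (φ.comp diagMap) ĝ (fun _ => diagTwist κ)) t t' U - homHubbardTT' φ t t' U =
      (homHubbardSpinMag φ (homSpinGaugeTransform φ ĝ (fun _ => κ)) t U - homHubbard φ t U) +
        (homHubbardSpinMag (φ.comp diagMap) (homSpinGaugeTransform (φ.comp diagMap) ĝ (fun _ => diagTwist κ)) t' 0 -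
          homHubbard (φ.comp diagMap) t' 0) := by
    rw [homHubbardSpinMagTT'Gen, homHubbardTT']
    abel
  rw [e]
  exact add_mem h1 h2

/-! ### §4. Transport of the EOM rows through `Ad(W_ĝ) ∘ Γ(ι_{Λ'})` -/

/-- **EOM rows in the spin-twisted `t–t'` torus**: `Φ = Ad(W_ĝ) ∘ Γ(ι_{Λ'})` carries the window commutator
`[h^{tt'}_{Λ'}, Γ(incl) B]` to the torus commutator `[H_κ^{tt'}, Φ(Γ(incl) B)]` (sharp torus hypothesis:
`thicken Λ 1 ⊆ Λ'`, `φ` injective on `Λ'`; non-degenerate hops of both graphs).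
[cite: Han2020Bootstrap, §3] [cite: Lieb1994, eq. (1)] [cite: BratteliRobinsonII1997, Thm. 6.2.4] -/
theorem homHubbardSpinMagTT'_commutator_orbGaugeAut_fermionEmbed (t t' U : ℝ) (κ : Fin 2 → Fin 2 → Circle)
    (χ : Site 2 → Fin 2 → Circle) (hχ : ∀ σ x y, χ (x + y) σ = χ x σ * χ y σ)
    (hχe : ∀ i σ, χ (unitVec i) σ = κ i σ) (ĝ : TorusSite d' N → Fin 2 → Circle)
    (hd : Function.Injective (signedHop φ)) (hd' : Function.Injective (signedHop (φ.comp diagMap)))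
    {Λ Λ' : Finset (Site 2)} (hΛ : Λ ⊆ Λ') (h8 : thicken Λ 1 ⊆ Λ')
    (hInj' : Set.InjOn φ ↑Λ') (hĝ : ∀ x ∈ Λ', ĝ (φ x) = χ x) (B : FermionOp Λ) :
    homHubbardSpinMagTT' φ κ t t' U *
          orbGaugeAut (spinSitePhase ĝ)
            (fermionEmbed (homEmb φ hInj') (fermionEmbed (PolySite.incl hΛ) B)) -
        orbGaugeAut (spinSitePhase ĝ)
            (fermionEmbed (homEmb φ hInj') (fermionEmbed (PolySite.incl hΛ) B)) *
          homHubbardSpinMagTT' φ κ t t' U =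
      orbGaugeAut (spinSitePhase ĝ)
        (fermionEmbed (homEmb φ hInj')
          ((hubbardTTPrimeFermionInteraction t t' U).localHamiltonian Λ' * fermionEmbed (PolySite.incl hΛ) B -
            fermionEmbed (PolySite.incl hΛ) B * (hubbardTTPrimeFermionInteraction t t' U).localHamiltonian Λ')) := by
  set H' := homHubbardSpinMagTT'Gen φ (homSpinGaugeTransform φ ĝ (fun _ => κ))
    (homSpinGaugeTransform (φ.comp diagMap) ĝ (fun _ => diagTwist κ)) t t' U with hH'
  set Z := fermionEmbed (homEmb φ hInj') (fermionEmbed (PolySite.incl hΛ) B) with hZ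
  have hgauge : homHubbardSpinMagTT' φ κ t t' U = orbGaugeAut (spinSitePhase ĝ) H' :=
    (orbGaugeAut_homHubbardSpinMagTT'Gen_homSpinGaugeTransform φ ĝ (fun _ => κ) (fun _ => diagTwist κ) t t' U).symm
  have hcomm : (H' - homHubbardTT' φ t t' U) * Z = Z * (H' - homHubbardTT' φ t t' U) := by
    have hm := homHubbardSpinMagTT'Gen_windowGauge_sub_mem φ t t' U κ χ hχ hχe ĝ hd hd' hΛ h8 hInj' hĝ
    rw [hZ, fermionEmbed_fermionEmbed]
    exact (commute_of_mem_carEvenSubalgebra hm (fermionEmbed_mem_carSubalgebra _ B) disjoint_compl_left).eq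
  have hsharp := homHubbardTT'_commutator_fermionEmbed φ t t' U hΛ h8 hInj' B
  rw [← hZ] at hsharp
  rw [hgauge, ← map_mul (orbGaugeAut (spinSitePhase ĝ)), ← map_mul (orbGaugeAut (spinSitePhase ĝ)),
    ← map_sub (orbGaugeAut (spinSitePhase ĝ)), ← hsharp]
  congr 1
  have e : H' = homHubbardTT' φ t t' U + (H' - homHubbardTT' φ t t' U) := by abel
  rw [e, Matrix.add_mul, Matrix.mul_add, hcomm]
  abel

end SpinTTPrimeWindowGauge

end Summit.Ventures.CertifiedManyBodySolver.Rows

end
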